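import Summits.CriticalPhenomena.SAWScalingLimit.Theses.SAWSpinMonotone
import Summits.CriticalPhenomena.SAWScalingLimit.Theorems.SAWSpinMonotoneSpinMonotoneAdjacentPortReduction
import Summits.CriticalPhenomena.SAWScalingLimit.Theorems.SAWSpinMonotoneSpinMonotoneExistsFarPort

/-!
# Skeleton of line `Sketch` (adjacent-port reduction) for the crux `SpinMonotone` (stmt-CriticalPhenomena-16769) — cycle 1 state

Route `SAWSpinMonotone`, sub-problem `CriticalPhenomena/SAWScalingLimit`, crux
`Summit.CriticalPhenomena.SAWScalingLimit.Theses.SAWSpinMonotone.SpinMonotone` (rank 2, item stmt-CriticalPhenomena-16769),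
lead `prover-line-stmt-CriticalPhenomena-16769-0`. Cards: `Cruxes/SpinMonotone/PICKED.md`,
`Cruxes/SpinMonotone/Ideas/notched-strip-transfer-matrix.md` (negation lens).

THE LINE. At a target `v` ADJACENT to the source vertex `w₁` of the boundary mid-edge `a = {u, w₁}` (`u ∉ Λ ∋ w₁`), no
self-avoiding walk of `Λ ∖ v` from `a` can wind around `v` (discrete Umlaufsatz + simple connectivity), so the walks to the three
ports `{v,w₁}`, `{v,p}` (mid), `{v,q}` (far) have the constant windings `ε·π/3`, `ε·π`, `ε·5π/3`; the port sum of the crux is the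
three-term trigonometric sum of the three port masses and its modulus is antitone on `[0, 3/2]` IFF `4 m₀ m₂ ≤ m₁ (m₀ + m₂)`.
Hence the crux splits EXACTLY as `AdjacentPortInequality ∧ NonAdjacentSpinMonotone` (`spinMonotone_iff_parts` below).

LANDED (this cycle): `stub_normSq_threeTerm` (…NormSqThreeTerm.lean, p172578), `stub_threeTermViolation` (…ThreeTermViolation.lean,
p172573), `stub_threeTermAntitone` (…ThreeTermAntitone.lean, p172540), `stub_exists_farPort` (…ExistsFarPort.lean, p172631),
`stub_adjacentWinding` (…AdjacentWinding.lean, p172568), vocabulary `IsFarPort / AdjacentConfig / AdjacentPortInequality /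
AdjacentPortWitness` (…AdjacentPortDefs.lean, p172613), glue `portSum_eq_threeTerm`, `adjacentPortInequality_of_spinMonotone :
SpinMonotone → AdjacentPortInequality`, `antitoneOn_adjacent_iff` (…AdjacentPortReduction.lean, p172870), negative-modulo lemma
`SpinMonotone_false_of_AdjacentPortWitness : AdjacentPortWitness → ¬ SpinMonotone`
(Theorems/SAWSpinMonotoneSpinMonotone/Negative/SpinMonotoneFalseOfAdjacentPortWitness.lean, p173009).

OPEN (the only sorries below): `stub_adjacentPortInequality` — THE COMPUTABLE CONJUNCT, decided by the two positive generating
functions `m(p), m(q)` (`m(w₁) = x_c`), forecast FALSE on notched armchair strips of width ≈ 18–21 (exact transfer matrices: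
margin `0.0453 → 0.00296` for widths `2 → 11`, `W⁻²` law, limit ≈ −0.002; an independent TM reproduces W ≤ 6 to all digits);
`stub_nonAdjacentSpinMonotone` — the rest of the crux (targets not adjacent to the source vertex), conjecture-grade.
-/

noncomputable section

namespace Summit.CriticalPhenomena.SAWScalingLimit.Cruxes.SpinMonotone.AdjacentPort

open Literature.Probability.LatticeModels
open Literature.Probability.RandomPlanarGeometry Literature.Probability.RandomPlanarGeometry.SAW
open Summit.CriticalPhenomena.SAWScalingLimit.Theses.SAWSpinMonotone (SpinMonotone)
open Summit.CriticalPhenomena.SAWScalingLimit.Cruxes.ArrivalFlattening.SpinChord (portMass portMass_nonneg)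

/-! ## Registered stubs still open -/

/-- S5 (THE COMPUTABLE CONJUNCT OF THE CRUX — decided by a transfer-matrix computation; forecast FALSE on notched armchair
strips of width ≈ 18–21, card `notched-strip-transfer-matrix`): the adjacent-port inequality `4·m(w₁)·m(q) ≤ m(p)·(m(w₁)+m(q))`
at every adjacent configuration (`q` the far port). Registered so that the disprover and the numerics aim at exactly this. -/
theorem stub_adjacentPortInequality : ∀ (Λ : Finset HexVertex) (u w₁ v p q : HexVertex),
    hexDomainSimplyConnected Λ → u ∉ Λ → w₁ ∈ Λ → v ∈ Λ → hexGraph.Adj u w₁ → hexGraph.Adj v w₁ →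
    hexGraph.Adj v p → hexGraph.Adj v q → w₁ ≠ p → p ≠ q → w₁ ≠ q →
    (∃ x y : HexVertex, x ≠ w₁ ∧ hexGraph.Adj u x ∧ hexGraph.Adj x y ∧ hexGraph.Adj y q) →
    4 * portMass Λ s(u, w₁) v w₁ * portMass Λ s(u, w₁) v q ≤
      portMass Λ s(u, w₁) v p * (portMass Λ s(u, w₁) v w₁ + portMass Λ s(u, w₁) v q) := by
  sorry

/-- S6 (THE REST OF THE CRUX): spin monotonicity at every target `v` NOT adjacent to the source vertex (the endpoint of `a`
inside `Λ`; includes the degenerate `v =` source vertex, where there are no walks). Conjecture-grade; margins at depth `≥ 2`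
are `≈ 4×` those of the adjacent case in all enumerations (refuter sweeps d ≤ 9, k2 series), so this conjunct may well be true. -/
theorem stub_nonAdjacentSpinMonotone : ∀ (Λ : Finset HexVertex), hexDomainSimplyConnected Λ →
    ∀ a ∈ hexDomainBoundary Λ, ∀ v ∈ Λ, (∀ w ∈ a, w ∈ Λ → ¬ hexGraph.Adj v w) →
    ∀ w₀ w₁ w₂ : HexVertex, hexGraph.Adj v w₀ → hexGraph.Adj v w₁ → hexGraph.Adj v w₂ →
    w₀ ≠ w₁ → w₁ ≠ w₂ → w₀ ≠ w₂ →
    AntitoneOn (fun s : ℝ =>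
      ‖hexParafermionicObservable (Λ.erase v) a hexCriticalFugacity s s(v, w₀) +
          hexParafermionicObservable (Λ.erase v) a hexCriticalFugacity s s(v, w₁) +
          hexParafermionicObservable (Λ.erase v) a hexCriticalFugacity s s(v, w₂)‖) (Set.Icc (0 : ℝ) (3 / 2)) := by
  sorry

/-! ## Assembly: the crux as `AdjacentPortInequality ∧ NonAdjacentSpinMonotone` -/

/-- Shape of S6: the crux at targets not adjacent to the source vertex. A statement, not asserted. -/
def NonAdjacentSpinMonotone : Prop := ∀ (Λ : Finset HexVertex), hexDomainSimplyConnected Λ →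
    ∀ a ∈ hexDomainBoundary Λ, ∀ v ∈ Λ, (∀ w ∈ a, w ∈ Λ → ¬ hexGraph.Adj v w) →
    ∀ w₀ w₁ w₂ : HexVertex, hexGraph.Adj v w₀ → hexGraph.Adj v w₁ → hexGraph.Adj v w₂ →
    w₀ ≠ w₁ → w₁ ≠ w₂ → w₀ ≠ w₂ →
    AntitoneOn (fun s : ℝ =>
      ‖hexParafermionicObservable (Λ.erase v) a hexCriticalFugacity s s(v, w₀) +
          hexParafermionicObservable (Λ.erase v) a hexCriticalFugacity s s(v, w₁) +
          hexParafermionicObservable (Λ.erase v) a hexCriticalFugacity s s(v, w₂)‖) (Set.Icc (0 : ℝ) (3 / 2))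

/-- The spelled-out form of S5 is `AdjacentPortInequality`. -/
theorem adjacentPortInequality_iff_spelled : AdjacentPortInequality ↔ ∀ (Λ : Finset HexVertex) (u w₁ v p q : HexVertex),
    hexDomainSimplyConnected Λ → u ∉ Λ → w₁ ∈ Λ → v ∈ Λ → hexGraph.Adj u w₁ → hexGraph.Adj v w₁ →
    hexGraph.Adj v p → hexGraph.Adj v q → w₁ ≠ p → p ≠ q → w₁ ≠ q →
    (∃ x y : HexVertex, x ≠ w₁ ∧ hexGraph.Adj u x ∧ hexGraph.Adj x y ∧ hexGraph.Adj y q) →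
    4 * portMass Λ s(u, w₁) v w₁ * portMass Λ s(u, w₁) v q ≤
      portMass Λ s(u, w₁) v p * (portMass Λ s(u, w₁) v w₁ + portMass Λ s(u, w₁) v q) := by
  constructor
  · intro h Λ u w₁ v p q hΛ hu hw₁ hv huw hvw hvp hvq n₁ n₂ n₃ hfar
    exact h Λ u w₁ v p q ⟨hΛ, hu, hw₁, hv, huw, hvw, hvp, hvq, n₁, n₂, n₃, hfar⟩
  · rintro h Λ u w₁ v p q ⟨hΛ, hu, hw₁, hv, huw, hvw, hvp, hvq, n₁, n₂, n₃, hfar⟩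
    exact h Λ u w₁ v p q hΛ hu hw₁ hv huw hvw hvp hvq n₁ n₂ n₃ hfar

/-- A neighbour of `v` is one of its three distinct neighbours (transport of `HV.eq_or_eq_or_eq_of_adj`). [folklore] -/
theorem eq_or_eq_or_eq_of_adj_hex {v p q r x : HexVertex} (hp : hexGraph.Adj v p) (hq : hexGraph.Adj v q)
    (hr : hexGraph.Adj v r) (hpq : p ≠ q) (hqr : q ≠ r) (hpr : p ≠ r) (hx : hexGraph.Adj v x) :
    x = p ∨ x = q ∨ x = r := by
  have hinj : Function.Injective toHV := hvEquiv.injective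
  have key := HV.eq_or_eq_or_eq_of_adj ((hexGraph_adj_iff_hvGraph_adj _ _).1 hp)
    ((hexGraph_adj_iff_hvGraph_adj _ _).1 hq) ((hexGraph_adj_iff_hvGraph_adj _ _).1 hr)
    (hinj.ne hpq) (hinj.ne hqr) (hinj.ne hpr) ((hexGraph_adj_iff_hvGraph_adj _ _).1 hx)
  rcases key with h | h | h
  · exact Or.inl (hinj h)
  · exact Or.inr (Or.inl (hinj h))
  · exact Or.inr (Or.inr (hinj h))

/-- From a configuration and the inequality, antitonicity of the port sum in ANY order of the three ports (landed
`antitoneOn_adjacent_iff`). -/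
theorem antitoneOn_of_config (hI : AdjacentPortInequality) {Λ : Finset HexVertex} {u w v p q : HexVertex}
    (hc : AdjacentConfig Λ u w v p q) {w₀ w₁ w₂ : HexVertex}
    (hperm : ∀ s : ℝ,
      hexParafermionicObservable (Λ.erase v) s(u, w) hexCriticalFugacity s s(v, w₀) +
          hexParafermionicObservable (Λ.erase v) s(u, w) hexCriticalFugacity s s(v, w₁) +
          hexParafermionicObservable (Λ.erase v) s(u, w) hexCriticalFugacity s s(v, w₂) =
        hexParafermionicObservable (Λ.erase v) s(u, w) hexCriticalFugacity s s(v, w) +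
          hexParafermionicObservable (Λ.erase v) s(u, w) hexCriticalFugacity s s(v, p) +
          hexParafermionicObservable (Λ.erase v) s(u, w) hexCriticalFugacity s s(v, q)) :
    AntitoneOn (fun s : ℝ =>
      ‖hexParafermionicObservable (Λ.erase v) s(u, w) hexCriticalFugacity s s(v, w₀) +
          hexParafermionicObservable (Λ.erase v) s(u, w) hexCriticalFugacity s s(v, w₁) +
          hexParafermionicObservable (Λ.erase v) s(u, w) hexCriticalFugacity s s(v, w₂)‖) (Set.Icc (0 : ℝ) (3 / 2)) := by
  have key := (antitoneOn_adjacent_iff hc).2 (hI Λ u w v p q hc)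
  intro s hs t ht hst
  simp only
  rw [hperm t, hperm s]
  exact key hs ht hst

/-- **Assembly**: the crux from the adjacent-port inequality (S5, through the landed reduction) and the non-adjacent part (S6). -/
theorem spinMonotone_of_parts (hI : AdjacentPortInequality) (hN : NonAdjacentSpinMonotone) : SpinMonotone := by
  intro Λ hΛ a ha v hv w₀ w₁ w₂ h₀ h₁ h₂ n₁ n₂ n₃
  by_cases hadj : ∀ w ∈ a, w ∈ Λ → ¬ hexGraph.Adj v w
  · exact hN Λ hΛ a ha v hv hadj w₀ w₁ w₂ h₀ h₁ h₂ n₁ n₂ n₃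
  push Not at hadj
  obtain ⟨w, hwa, hwΛ, hvw⟩ := hadj
  obtain ⟨he, u, w', rfl, hw'Λ, huΛ⟩ := ha
  obtain rfl : w = w' := by
    rcases Sym2.mem_iff.1 hwa with rfl | rfl
    · exact absurd hwΛ huΛ
    · rfl
  have huw : hexGraph.Adj u w := (SimpleGraph.mem_edgeSet hexGraph).1 he
  have huv : u ≠ v := fun h => huΛ (h ▸ hv)
  rcases eq_or_eq_or_eq_of_adj_hex h₀ h₁ h₂ n₁ n₂ n₃ hvw with rfl | rfl | rfl
  · -- the source vertex is `w₀`; ports `w₁`, `w₂`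
    rcases stub_exists_farPort u w v w₁ w₂ huw h₀ h₁ h₂ huv n₁ n₂ n₃ with hfar | hfar
    · exact antitoneOn_of_config hI ⟨hΛ, huΛ, hwΛ, hv, huw, h₀, h₂, h₁, n₃, n₂.symm, n₁, hfar⟩ (fun s => by abel)
    · exact antitoneOn_of_config hI ⟨hΛ, huΛ, hwΛ, hv, huw, h₀, h₁, h₂, n₁, n₂, n₃, hfar⟩ (fun s => by abel)
  · -- the source vertex is `w₁`; ports `w₀`, `w₂`
    rcases stub_exists_farPort u w v w₀ w₂ huw h₁ h₀ h₂ huv n₁.symm n₃ n₂ with hfar | hfar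
    · exact antitoneOn_of_config hI ⟨hΛ, huΛ, hwΛ, hv, huw, h₁, h₂, h₀, n₂, n₃.symm, n₁.symm, hfar⟩ (fun s => by abel)
    · exact antitoneOn_of_config hI ⟨hΛ, huΛ, hwΛ, hv, huw, h₁, h₀, h₂, n₁.symm, n₃, n₂, hfar⟩ (fun s => by abel)
  · -- the source vertex is `w₂`; ports `w₀`, `w₁`
    rcases stub_exists_farPort u w v w₀ w₁ huw h₂ h₀ h₁ huv n₃.symm n₁ n₂.symm with hfar | hfar
    · exact antitoneOn_of_config hI ⟨hΛ, huΛ, hwΛ, hv, huw, h₂, h₁, h₀, n₂.symm, n₁.symm, n₃.symm, hfar⟩ (fun s => by abel)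
    · exact antitoneOn_of_config hI ⟨hΛ, huΛ, hwΛ, hv, huw, h₂, h₀, h₁, n₃.symm, n₁, n₂.symm, hfar⟩ (fun s => by abel)

/-- **The crux is EXACTLY `AdjacentPortInequality ∧ NonAdjacentSpinMonotone`** (both conjuncts follow from it: the first by the
landed `adjacentPortInequality_of_spinMonotone`, the second by restriction). -/
theorem spinMonotone_iff_parts : SpinMonotone ↔ AdjacentPortInequality ∧ NonAdjacentSpinMonotone := by
  constructor
  · intro hFM
    refine ⟨adjacentPortInequality_of_spinMonotone hFM, ?_⟩
    intro Λ hΛ a ha v hv _ w₀ w₁ w₂ h₀ h₁ h₂ n₁ n₂ n₃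
    exact hFM Λ hΛ a ha v hv w₀ w₁ w₂ h₀ h₁ h₂ n₁ n₂ n₃
  · rintro ⟨hI, hN⟩
    exact spinMonotone_of_parts hI hN

/-- **`SpinMonotone_proof`**: the crux from the two open registered stubs (S5, S6) and the landed reduction. -/
theorem SpinMonotone_proof : SpinMonotone :=
  spinMonotone_of_parts (adjacentPortInequality_iff_spelled.2 stub_adjacentPortInequality) stub_nonAdjacentSpinMonotone

end Summit.CriticalPhenomena.SAWScalingLimit.Cruxes.SpinMonotone.AdjacentPort

end
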